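import Summits.ValiantsHypothesis.ValiantsHypothesis.Theorems.DivisionGapPerDivisionHardStubKeyRigid
import Summits.ValiantsHypothesis.ValiantsHypothesis.Theorems.DivisionGapPerDivisionHardStubKeyOfSpan
import Summits.ValiantsHypothesis.ValiantsHypothesis.Theorems.DivisionGapPerDivisionHardStubFarRigid
import Summits.ValiantsHypothesis.ValiantsHypothesis.Theorems.DivisionGapPerDivisionHardStubTorusSupport
import Summits.ValiantsHypothesis.ValiantsHypothesis.Theorems.DivisionGapPerDivisionHardStubFaceDescent
import Summits.ValiantsHypothesis.ValiantsHypothesis.Theorems.DivisionGapPerDivisionHardStubJssContraction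
import Summits.ValiantsHypothesis.ValiantsHypothesis.Theorems.DivisionGapPerDivisionHardStubBlockArsenal

/-!
# Crux `DivisionGap.PerDivisionHard` (stmt-ValiantsHypothesis-5065), line `pair-descent-jss-endpoint` —
the KEY rung and the CODE rung (skeleton v15.1, chapter RIGID CELLS, parts C and D)

`PerDivisionHard` asks: for every `c`, for all large `n`, every nonzero `h ∈ ℝ≥0[x_ij]` has
`2^{(log₂ n + c)^c} < L(per_n · h) + L(h)`.  Two more UNCONDITIONAL rungs obtained from the prover's
freedom of PLACEMENT alone (generic cut, no prices, no counting over placements):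

* **KEY rung** (`perDivisionHard_key`).  A cell set `K` is a KEY for `h` if two monomials of `h` that
  agree on `K` are equal.  If `h` has a key of size `≤ n/4` then the crux inequality holds: place the
  block arsenal `G(b,1) ⊕ M₀` with its face OFF `K` (`stub_keyPlacement`: active lines off the lines
  of `K`, padding matching avoiding `K` by Hall's theorem), take the generic cut — two fibre monomials
  agree off the face, hence on `K`, hence everywhere (`stub_keyRigid`).
* **FEW-GENERATORS corollary** (`perDivisionHard_fewGenerators`).  A cofactor all of whose exponent
  vectors lie in the monoid generated by `q ≤ n/4` exponent vectors `v_1, …, v_q` — e.g. ANY nonzero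
  polynomial `F(x^{v_1}, …, x^{v_q})` in `q` monomials, of any degree and density — never helps: the
  `ℤ`-span of the `v_s` is read off `≤ q` cells (`stub_keyOfSpan`, linear algebra over `ℚ`).  This is
  incomparable with the sparse rung (`Σ_e x_e` is sparse with no small key; `F` may have `2^{poly(n)}`
  monomials) and with the rank chapter.
* **CODE rung** (`perDivisionHard_minDistance`).  If any two distinct monomials of `h` WITH EQUAL MARGINS
  differ in more than `n + 2(log₂ n + d)^d` cells, the crux inequality holds: at ANY placement two
  distinct monomials of the generic cut's fibre would differ only inside the face, which has
  `n + 2b² - b` cells (`stub_farRigid`, `card_placedBlock_le`).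

Residual gain: an undecided cofactor has two equal-margin monomials at Hamming distance `≤ n + polylog²(n)`
and no `n/4` cells determine its monomials (in particular it is not a polynomial in `≤ n/4` monomials).
-/

noncomputable section

-- `Summit.ValiantsHypothesis.ValiantsHypothesis.…` is the tree's mandated single-conjunct layout
-- (Sub = Summit), so the duplicated namespace component is intended.
set_option linter.dupNamespace false

namespace Summit.ValiantsHypothesis.ValiantsHypothesis.Theorems.DivisionGapPerDivisionHard

open MvPolynomial Literature.Computability.AlgebraicComplexity
open scoped NNReal

/-- The common tail of the line's rungs: from a rigid placement (`CutsOut` + `HasSingleGPart` on a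
placed block with `b ≥ (log₂ n + d)^d`, `d` the arsenal exponent) for a torus normal form `h'` of `h`
to the crux inequality for `h` — face descent, JSS contraction, the placed face is harder. [folklore] -/
theorem two_pow_lt_of_rigid (c κ d n₁ n : ℕ)
    (hcon : ∀ (n : ℕ) (f : MvPolynomial (Fin n × Fin n) ℝ≥0) (u : (Fin n × Fin n) →₀ ℕ),
      complexity f ≤ ((n + 2) * (complexity (monomial u (1 : ℝ≥0) * f) + 2)) ^ κ)
    (hhard : ∀ n ≥ n₁, ∀ (b k m : ℕ) (eR eC : BlockV b k m ≃ Fin n),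
      (Nat.log 2 n + d) ^ d ≤ b →
      ((n + 2) * (2 ^ ((Nat.log 2 n + c) ^ c) + 3)) ^ κ < complexity (facePer (placedBlock eR eC)))
    (hn : n₁ ≤ n) {h h' : MvPolynomial (Fin n × Fin n) ℝ≥0} (hh' : h' ≠ 0)
    (hle1 : complexity (perPoly (Fin n) ℝ≥0 * h') ≤ complexity (perPoly (Fin n) ℝ≥0 * h))
    {b k m : ℕ} (eR eC : BlockV b k m ≃ Fin n) (w : Fin n × Fin n → ℕ) (u : (Fin n × Fin n) →₀ ℕ)
    (hb : (Nat.log 2 n + d) ^ d ≤ b) (hcut : CutsOut w (placedBlock eR eC))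
    (hsingle : HasSingleGPart (placedBlock eR eC) w h' u) :
    2 ^ ((Nat.log 2 n + c) ^ c) < complexity (perPoly (Fin n) ℝ≥0 * h) + complexity h := by
  by_contra hlt
  have hle : complexity (perPoly (Fin n) ℝ≥0 * h) + complexity h ≤
      2 ^ ((Nat.log 2 n + c) ^ c) := not_lt.mp hlt
  have hdesc := stub_faceDescent n (placedBlock eR eC) w h' u hcut hh' hsingle
  have h1 : complexity (monomial u (1 : ℝ≥0) * facePer (placedBlock eR eC)) ≤
      2 ^ ((Nat.log 2 n + c) ^ c) + 1 :=
    calc complexity (monomial u (1 : ℝ≥0) * facePer (placedBlock eR eC))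
        ≤ complexity (perPoly (Fin n) ℝ≥0 * h') + 1 := hdesc
      _ ≤ complexity (perPoly (Fin n) ℝ≥0 * h) + 1 := Nat.add_le_add_right hle1 1
      _ ≤ 2 ^ ((Nat.log 2 n + c) ^ c) + 1 :=
          Nat.add_le_add_right (le_trans (Nat.le_add_right _ _) hle) 1
  have h2 : complexity (facePer (placedBlock eR eC)) ≤
      ((n + 2) * (2 ^ ((Nat.log 2 n + c) ^ c) + 3)) ^ κ :=
    calc complexity (facePer (placedBlock eR eC))
        ≤ ((n + 2) * (complexity (monomial u (1 : ℝ≥0) * facePer (placedBlock eR eC)) + 2)) ^ κ :=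
          hcon n (facePer (placedBlock eR eC)) u
      _ ≤ ((n + 2) * (2 ^ ((Nat.log 2 n + c) ^ c) + 3)) ^ κ :=
          Nat.pow_le_pow_left (Nat.mul_le_mul_left _ (by omega)) κ
  have h3 := hhard n hn b k m eR eC hb
  exact absurd (lt_of_lt_of_le h3 h2) (lt_irrefl _)

/-- **The KEY rung of `PerDivisionHard`.**  For every `c` there is `n₀` such that for all `n ≥ n₀` and
every nonzero `h ∈ ℝ≥0[x_ij]`: if some cell set `K` with `4|K| ≤ n` is a key for `h` (monomials of `h`
agreeing on `K` are equal), then `2^{(log₂ n+c)^c} < L(per_n·h) + L(h)`.  Torus normal form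
(sub-support, so `K` stays a key), rigidity `stub_keyRigid`, then the common tail. -/
theorem perDivisionHard_key :
    ∀ c : ℕ, ∃ n₀ : ℕ, ∀ n ≥ n₀, ∀ h : MvPolynomial (Fin n × Fin n) ℝ≥0, h ≠ 0 →
      ∀ K : Finset (Fin n × Fin n), 4 * K.card ≤ n →
      (∀ m₁ ∈ h.support, ∀ m₂ ∈ h.support, (∀ e ∈ K, m₁ e = m₂ e) → m₁ = m₂) →
      2 ^ ((Nat.log 2 n + c) ^ c) < complexity (perPoly (Fin n) ℝ≥0 * h) + complexity h := by
  intro c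
  obtain ⟨κ, hcon⟩ := stub_jssContraction
  obtain ⟨d, n₁, hhard⟩ := stub_blockArsenal c κ
  obtain ⟨n₀, hS⟩ := stub_keyRigid d
  refine ⟨n₀ + n₁, fun n hn h hh K hK hkey => ?_⟩
  obtain ⟨h', hh', htor, hsupp, hle1, -⟩ := stub_torusSupport n h hh
  obtain ⟨b, k, m, eR, eC, w, u, hb, hcut, hsingle⟩ := hS n (by omega) h' hh' htor K hK
    fun m₁ hm₁ m₂ hm₂ hK' => hkey m₁ (hsupp hm₁) m₂ (hsupp hm₂) hK'
  exact two_pow_lt_of_rigid c κ d n₁ n hcon hhard (by omega) hh' hle1 eR eC w u hb hcut hsingle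

/-- **The FEW-GENERATORS rung of `PerDivisionHard`: a cofactor that is a polynomial in at most `n/4`
monomials never helps.**  For every `c` there is `n₀` such that for all `n ≥ n₀`: a nonzero `h` all of
whose exponent vectors lie in the monoid generated by `q` exponent vectors `v_1, …, v_q` with
`4q ≤ n` (e.g. any nonzero `F(x^{v_1}, …, x^{v_q})`, of any degree and density) satisfies
`2^{(log₂ n+c)^c} < L(per_n·h) + L(h)` (`stub_keyOfSpan` + `perDivisionHard_key`). -/
theorem perDivisionHard_fewGenerators :
    ∀ c : ℕ, ∃ n₀ : ℕ, ∀ n ≥ n₀, ∀ (q : ℕ) (v : Fin q → (Fin n × Fin n) →₀ ℕ)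
      (h : MvPolynomial (Fin n × Fin n) ℝ≥0), h ≠ 0 → 4 * q ≤ n →
      (∀ mm ∈ h.support, ∃ a : Fin q → ℕ, mm = ∑ s, a s • v s) →
      2 ^ ((Nat.log 2 n + c) ^ c) < complexity (perPoly (Fin n) ℝ≥0 * h) + complexity h := by
  intro c
  obtain ⟨n₀, hkey⟩ := perDivisionHard_key c
  refine ⟨n₀, fun n hn q v h hh hq hgen => ?_⟩
  obtain ⟨K, hKq, hK⟩ := stub_keyOfSpan n q (fun s e => (v s e : ℤ)) h.support (by
    intro m₁ hm₁ m₂ hm₂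
    obtain ⟨a₁, rfl⟩ := hgen m₁ hm₁
    obtain ⟨a₂, rfl⟩ := hgen m₂ hm₂
    refine ⟨fun s => (a₁ s : ℤ) - a₂ s, fun e => ?_⟩
    simp only [Finsupp.coe_finsetSum, Finsupp.coe_smul, Finset.sum_apply, Pi.smul_apply, smul_eq_mul,
      Nat.cast_sum, Nat.cast_mul, sub_mul, Finset.sum_sub_distrib])
  exact hkey n hn h hh K (by omega) hK

/-- **The CODE (minimum-distance) rung of `PerDivisionHard`.**  For every `c` there are `d, n₀` such that
for all `n ≥ n₀` and every nonzero `h`: if any two distinct monomials of `h` with equal row margins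
and equal column margins differ in more than `n + 2(log₂ n + d)^d` cells, then
`2^{(log₂ n+c)^c} < L(per_n·h) + L(h)` (`stub_farRigid` at any placement). -/
theorem perDivisionHard_minDistance :
    ∀ c : ℕ, ∃ d n₀ : ℕ, ∀ n ≥ n₀, ∀ h : MvPolynomial (Fin n × Fin n) ℝ≥0, h ≠ 0 →
      (∀ m₁ ∈ h.support, ∀ m₂ ∈ h.support, m₁ ≠ m₂ → rowDegrees m₁ = rowDegrees m₂ →
        Finsupp.mapDomain Prod.snd m₁ = Finsupp.mapDomain Prod.snd m₂ →
        n + 2 * (Nat.log 2 n + d) ^ d < (Finset.univ.filter fun e : Fin n × Fin n => m₁ e ≠ m₂ e).card) →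
      2 ^ ((Nat.log 2 n + c) ^ c) < complexity (perPoly (Fin n) ℝ≥0 * h) + complexity h := by
  intro c
  obtain ⟨κ, hcon⟩ := stub_jssContraction
  obtain ⟨d, n₁, hhard⟩ := stub_blockArsenal c κ
  obtain ⟨n₀, hS⟩ := stub_farRigid d
  refine ⟨d + d, n₀ + n₁, fun n hn h hh hfar => ?_⟩
  obtain ⟨h', hh', htor, hsupp, hle1, -⟩ := stub_torusSupport n h hh
  have hfar' : ∀ m₁ ∈ h'.support, ∀ m₂ ∈ h'.support, m₁ ≠ m₂ →
      n + 2 * ((Nat.log 2 n + d) ^ d * (Nat.log 2 n + d) ^ d) <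
        (Finset.univ.filter fun e : Fin n × Fin n => m₁ e ≠ m₂ e).card := by
    intro m₁ hm₁ m₂ hm₂ hne
    obtain ⟨r₀, c₀, hrc⟩ := htor
    refine lt_of_le_of_lt ?_ (hfar m₁ (hsupp hm₁) m₂ (hsupp hm₂) hne
      ((hrc m₁ hm₁).1.trans (hrc m₂ hm₂).1.symm) ((hrc m₁ hm₁).2.trans (hrc m₂ hm₂).2.symm))
    rw [← pow_add]
    exact Nat.add_le_add_left (Nat.mul_le_mul_left 2 (Nat.pow_le_pow_left (by omega) _)) n
  obtain ⟨b, k, m, eR, eC, w, u, hb, hcut, hsingle⟩ := hS n (by omega) h' hh' htor hfar'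
  exact two_pow_lt_of_rigid c κ d n₁ n hcon hhard (by omega) hh' hle1 eR eC w u hb hcut hsingle

/-- **Pair interface of the KEY rung** (for descent-type transfers): the crux inequality for `(h, h')`
as soon as `h'` is nonzero, torus-homogeneous, has a key `K` with `4|K| ≤ n`, and is no more
expensive than `h` on the `per`-side. -/
theorem two_pow_lt_pair_of_key (c : ℕ) :
    ∃ n₀ : ℕ, ∀ n ≥ n₀, ∀ h h' : MvPolynomial (Fin n × Fin n) ℝ≥0, h' ≠ 0 → IsTorusHomogeneous h' →
      complexity (perPoly (Fin n) ℝ≥0 * h') ≤ complexity (perPoly (Fin n) ℝ≥0 * h) →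
      ∀ K : Finset (Fin n × Fin n), 4 * K.card ≤ n →
      (∀ m₁ ∈ h'.support, ∀ m₂ ∈ h'.support, (∀ e ∈ K, m₁ e = m₂ e) → m₁ = m₂) →
      2 ^ ((Nat.log 2 n + c) ^ c) < complexity (perPoly (Fin n) ℝ≥0 * h) + complexity h := by
  obtain ⟨κ, hcon⟩ := stub_jssContraction
  obtain ⟨d, n₁, hhard⟩ := stub_blockArsenal c κ
  obtain ⟨n₀, hS⟩ := stub_keyRigid d
  refine ⟨n₀ + n₁, fun n hn h h' hh' htor hle1 K hK hkey => ?_⟩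
  obtain ⟨b, k, m, eR, eC, w, u, hb, hcut, hsingle⟩ := hS n (by omega) h' hh' htor K hK hkey
  exact two_pow_lt_of_rigid c κ d n₁ n hcon hhard (by omega) hh' hle1 eR eC w u hb hcut hsingle

end Summit.ValiantsHypothesis.ValiantsHypothesis.Theorems.DivisionGapPerDivisionHard

end
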